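import Mathlib
import Summits.NavierStokesRegularity.NavierStokesRegularity.Theorems.QuarterLogPincerFlatChainDefs
import Summits.NavierStokesRegularity.NavierStokesRegularity.Theorems.QuarterLogPincerCubicRungDefs
import HarnessLib

/-!
# Negative lane for ⟨stmt-NavierStokesRegularity-24077⟩ — LINE `flat_chain` / g14-2 `slice_census`:
# the admissibility THRESHOLD of the census node `SliceCensus` (refuter / instrument seat ns-afl-r1 g13)

Typed smell (AUDIT v11 §2, price P-threshold), now BY NAME over the typer's verbatim port
`Theorems/QuarterLogPincerFlatChainDefs.lean` (part 2) of ns-idea-7 g14's workfile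
`Cruxes/TypeIQuantSubcubicExp/Lines/flat_chain.lean` §7:

* `heavySlice_of_no_admissible` — if NO block ratio `ρ` is admissible at separation `a`
  (`4M ≤ ρ`, `ϑ ≤ ρ`, `4Λρ ≤ e^a` jointly unsatisfiable, e.g. `e^a < 4Λ·max(4M, ϑ)`), then EVERY level is a heavy slice,
  vacuously; hence `card_filter_heavySlice_eq` — the census count of a violator of `n` levels is `n` itself.
* `quantCubicExpAt_of_sliceCensusAt_of_no_admissible` / `…_below_threshold` — consequently, below the admissibility
  threshold the census statement `SliceCensusAt M γ ϑ Λ a C` (any `a > 0`) already IS the cubic rung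
  `CubicRung.QuantCubicExpAt M` (with `K = a·(max C 0 + 2)`): the `∃ a₀` of `FlatChain.SliceCensus` must therefore be read
  as `a₀ ≥ log(4Λ·max(4M, ϑ))`, or the node contains the target.
* `sliceCensusAt_of_quantCubicExpAt` — conversely the rung at `M` gives the census at EVERY separation `a > 0` with
  `C = K⁺/a + 1`: the census node is NECESSARY for the rung (no strength is lost through LINE g14-2's kernel
  `typeIQuantCubicExp_of_sliceCensus`), at any threshold.

Theorem-only; standard axioms; no Theses decl and no statement of the line is asserted — these are facts about the
line's own objects.  HONEST LABEL: nothing here bears on the truth of ⟨24077⟩, of `SliceCensus`, of W7 or of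
Navier–Stokes regularity (all OPEN / not proved).  `--supports stmt-NavierStokesRegularity-24077`.
-/

set_option linter.dupNamespace false

noncomputable section

namespace Summit.NavierStokesRegularity.NavierStokesRegularity.Theorems.TypeIQuantSubcubicExp.Negative.SliceCensusThreshold

open MeasureTheory Set Metric
open scoped ENNReal NNReal Classical
open Literature.Analysis Literature.Analysis.FluidPDE
open Summit.NavierStokesRegularity.NavierStokesRegularity.Cruxes.TypeIQuantSubcubicExp.FlatChain
open Summit.NavierStokesRegularity.NavierStokesRegularity.Cruxes.TypeIQuantSubcubicExp.CubicRung

/-- Below the admissibility threshold every level is a heavy slice (vacuously: no `ρ` is admissible). -/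
theorem heavySlice_of_no_admissible {M γ ϑ Λ a : ℝ}
    {u : ℝ → EuclideanSpace ℝ (Fin 3) → EuclideanSpace ℝ (Fin 3)} {t₁ : ℝ} {x₀ : EuclideanSpace ℝ (Fin 3)} {k : ℕ}
    (hthr : ∀ ρ : ℝ, 4 * M ≤ ρ → ϑ ≤ ρ → Real.exp a < 4 * Λ * ρ) : HeavySlice M γ ϑ Λ a u t₁ x₀ k :=
  fun ρ h1 h2 h3 _ => absurd h3 (not_le.2 (hthr ρ h1 h2))

/-- The threshold in closed form: `e^a < 4Λ·max(4M, ϑ)` with `Λ > 0` leaves no admissible `ρ`. -/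
theorem no_admissible_of_lt_threshold {M ϑ Λ a : ℝ} (hΛ : 0 < Λ)
    (hthr : Real.exp a < 4 * Λ * max (4 * M) ϑ) :
    ∀ ρ : ℝ, 4 * M ≤ ρ → ϑ ≤ ρ → Real.exp a < 4 * Λ * ρ := by
  intro ρ h1 h2
  have h4 : 0 < 4 * Λ := by positivity
  exact hthr.trans_le (mul_le_mul_of_nonneg_left (max_le h1 h2) h4.le)

/-- Below the threshold the census count of `n` levels is `n`. -/
theorem card_filter_heavySlice_eq {M γ ϑ Λ a : ℝ}
    {u : ℝ → EuclideanSpace ℝ (Fin 3) → EuclideanSpace ℝ (Fin 3)} {t₁ : ℝ} {x₀ : EuclideanSpace ℝ (Fin 3)}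
    (hthr : ∀ ρ : ℝ, 4 * M ≤ ρ → ϑ ≤ ρ → Real.exp a < 4 * Λ * ρ) (n : ℕ) :
    ((Finset.range n).filter fun k => HeavySlice M γ ϑ Λ a u t₁ x₀ (k + 1)).card = n := by
  rw [Finset.filter_true_of_mem fun k _ => heavySlice_of_no_admissible hthr, Finset.card_range]

/-- **P-threshold.** Below the admissibility threshold, `SliceCensusAt M γ ϑ Λ a C` with `a > 0` is the cubic rung
`QuantCubicExpAt M` (constant `K = a·(max C 0 + 2)`). -/
theorem quantCubicExpAt_of_sliceCensusAt_of_no_admissible {M γ ϑ Λ a C : ℝ} (ha : 0 < a)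
    (hthr : ∀ ρ : ℝ, 4 * M ≤ ρ → ϑ ≤ ρ → Real.exp a < 4 * Λ * ρ) (h : SliceCensusAt M γ ϑ Λ a C) :
    QuantCubicExpAt M := by
  refine ⟨a * (max C 0 + 2), ?_⟩
  intro T τ A u p hframe hτ hrate hL3 hA t ht x
  by_contra hviol
  push Not at hviol
  have ht0 : 0 < t := ht.1
  have hA1 : (1 : ℝ) ≤ A := by linarith
  have hA3 : (1 : ℝ) ≤ A ^ 3 := one_le_pow₀ hA1
  have hC0 : 0 ≤ max C 0 := le_max_right _ _
  -- the number of levels the point violates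
  set n : ℕ := ⌊max C 0 * A ^ 3⌋₊ + 1 with hn
  have hn_gt : max C 0 * A ^ 3 < n := by
    rw [hn]; push_cast; exact Nat.lt_floor_add_one _
  have hn_le : (n : ℝ) ≤ max C 0 * A ^ 3 + 1 := by
    rw [hn]; push_cast; linarith [Nat.floor_le (by positivity : 0 ≤ max C 0 * A ^ 3)]
  -- the violator inequality at level `n`
  have hsq : t ^ (-(1 / 2 : ℝ)) * Real.sqrt t = 1 := by
    rw [Real.sqrt_eq_rpow, ← Real.rpow_add ht0]; norm_num
  have hexp : Real.exp (a * (n + 1)) ≤ ‖u t x‖ * Real.sqrt t := by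
    have h1 : a * (n + 1) ≤ a * (max C 0 + 2) * A ^ 3 := by
      have : (n : ℝ) + 1 ≤ (max C 0 + 2) * A ^ 3 := by nlinarith
      nlinarith
    calc Real.exp (a * (n + 1)) ≤ Real.exp (a * (max C 0 + 2) * A ^ 3) := Real.exp_le_exp.2 h1
      _ = Real.exp (a * (max C 0 + 2) * A ^ 3) * (t ^ (-(1 / 2 : ℝ)) * Real.sqrt t) := by
          rw [hsq, mul_one]
      _ = Real.exp (a * (max C 0 + 2) * A ^ 3) * t ^ (-(1 / 2 : ℝ)) * Real.sqrt t := by ring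
      _ ≤ ‖u t x‖ * Real.sqrt t :=
          mul_le_mul_of_nonneg_right hviol.le (Real.sqrt_nonneg _)
  -- the census below threshold counts all `n` levels
  have hcount := h T τ A t x u p n hframe hτ hrate hL3 hA ht hexp
  rw [card_filter_heavySlice_eq hthr n] at hcount
  have : (n : ℝ) ≤ max C 0 * A ^ 3 :=
    hcount.trans (mul_le_mul_of_nonneg_right (le_max_left _ _) (by positivity))
  linarith

/-- **P-threshold, closed form.** `e^a < 4Λ·max(4M, ϑ)`, `Λ > 0`, `a > 0`: the census statement is the rung. -/
theorem quantCubicExpAt_of_sliceCensusAt_below_threshold {M γ ϑ Λ a C : ℝ} (ha : 0 < a) (hΛ : 0 < Λ)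
    (hthr : Real.exp a < 4 * Λ * max (4 * M) ϑ) (h : SliceCensusAt M γ ϑ Λ a C) : QuantCubicExpAt M :=
  quantCubicExpAt_of_sliceCensusAt_of_no_admissible ha (no_admissible_of_lt_threshold hΛ hthr) h

/-- **Converse (any threshold).** The rung at `M` implies the census at every separation `a > 0`, with
`C = max K 0 / a + 1`: a violator of `n` levels forces `a(n+1) ≤ K⁺A³`, so `n ≤ (K⁺/a)·A³ ≤ C·A³` whatever is counted. -/
theorem sliceCensusAt_of_quantCubicExpAt {M γ ϑ Λ a : ℝ} (ha : 0 < a) (h : QuantCubicExpAt M) :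
    ∃ C : ℝ, SliceCensusAt M γ ϑ Λ a C := by
  obtain ⟨K, hK⟩ := h
  refine ⟨max K 0 / a + 1, ?_⟩
  intro T τ A t₁ x₀ u p n hframe hτ hrate hL3 hA ht₁ hviol
  have ht0 : 0 < t₁ := ht₁.1
  have hA1 : (1 : ℝ) ≤ A := by linarith
  have hA3 : (1 : ℝ) ≤ A ^ 3 := one_le_pow₀ hA1
  have hK0 : K ≤ max K 0 := le_max_left _ _
  have hsq : t₁ ^ (-(1 / 2 : ℝ)) * Real.sqrt t₁ = 1 := by
    rw [Real.sqrt_eq_rpow, ← Real.rpow_add ht0]; norm_num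
  -- the rung at the violating point
  have hpt : ‖u t₁ x₀‖ * Real.sqrt t₁ ≤ Real.exp (max K 0 * A ^ 3) := by
    have h1 := hK T τ A u p hframe hτ hrate hL3 hA t₁ ht₁ x₀
    calc ‖u t₁ x₀‖ * Real.sqrt t₁ ≤ Real.exp (K * A ^ 3) * t₁ ^ (-(1 / 2 : ℝ)) * Real.sqrt t₁ :=
          mul_le_mul_of_nonneg_right h1 (Real.sqrt_nonneg _)
      _ = Real.exp (K * A ^ 3) := by rw [mul_assoc, hsq, mul_one]
      _ ≤ Real.exp (max K 0 * A ^ 3) :=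
          Real.exp_le_exp.2 (mul_le_mul_of_nonneg_right hK0 (by positivity))
  have hle : a * (n + 1) ≤ max K 0 * A ^ 3 := Real.exp_le_exp.1 (hviol.trans hpt)
  -- count: the filtered set has at most `n` elements
  have hcard : (((Finset.range n).filter fun k => HeavySlice M γ ϑ Λ a u t₁ x₀ (k + 1)).card : ℝ) ≤ n := by
    exact_mod_cast (Finset.card_filter_le _ _).trans (Finset.card_range n).le
  have hn : (n : ℝ) ≤ max K 0 / a * A ^ 3 := by
    rw [div_mul_eq_mul_div, le_div_iff₀ ha]; nlinarith
  calc (((Finset.range n).filter fun k => HeavySlice M γ ϑ Λ a u t₁ x₀ (k + 1)).card : ℝ) ≤ n := hcard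
    _ ≤ max K 0 / a * A ^ 3 := hn
    _ ≤ (max K 0 / a + 1) * A ^ 3 := by nlinarith [div_nonneg (le_max_right K 0) ha.le]

end Summit.NavierStokesRegularity.NavierStokesRegularity.Theorems.TypeIQuantSubcubicExp.Negative.SliceCensusThreshold

end
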